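import Summits.Ventures.YMGap.RobustBall.IndexedMember
import Summits.Ventures.YMGap.RobustBall.PairCouplingGeometry
import Summits.Ventures.YMGap.RobustBall.AxialPairWitness
import HarnessLib

/-!
# Venture YMGap, track ROBUST-BALL (tier 2) — EVERY summable two-plaquette coupling is a member of the
# weighted ball, with loads read off its row and column sums

HONEST FRAMING. WHAT THIS IS: a venture file (cell `pub-ymgap`, track Y2 ROBUST-BALL, seat rb-p1), a
STRUCTURAL membership theorem for the tier-2 ball `MemBallZdS a Λ t` (`MassGapOnBallS.lean`). A general
TWO-PLAQUETTE COUPLING `J : ZdPlaquette d × ZdPlaquette d → ℝ` defines the link potential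
`plaqPairCoupling N J`: on each link set `X`, the sum over ordered pairs `(p, q)` with
`edges p ∪ edges q = X` of `J(p, q) (Re tr U_p/N)(Re tr U_q/N)` (gauge invariant; any orientations, any
positions — effective actions after block-spin steps are of this type). THEOREM
`memBallZdS_plaqPairCoupling`: if the rows and columns of `|J|` are summable with
`∑_q |J(p,q)| ≤ K₀`, `∑_p |J(p,q)| ≤ K₀'` and, at weight `t ≥ 0`,
`∑_q |J(p,q)| e^{t(‖x_p - x_q‖_∞ + 1)} ≤ K_t`, `∑_p (same) ≤ K_t'`, then
`plaqPairCoupling N J ∈ MemBallZdS (4(d-1)(K₀ + K₀')) (8(d-1)(e^{t}(K₀ + K₀') + K_t + K_t')/√N) t`.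
(The axial-pair witness of `AxialPairWitness.lean` is the case `J(p, p + (n+1)e_a) = τκ^{n+1}`.) WHAT IT IS
NOT: no claim about which couplings an actual renormalisation flow produces; a strong-coupling lattice
statement; nothing about the continuum limit or the Clay Millennium problem.

References: loads/ball of `MassGapOnBallS.lean`; counting after Shen–Zhu–Zhu, CMP 400 (2023), §2.
-/

noncomputable section

open MeasureTheory Filter Function Topology Real Finset
open Literature.Probability.LatticeModels
open Literature.Probability.LatticeModels.DobrushinMetric
open Literature.MathematicalPhysics.QuantumLattice
open Literature.MathematicalPhysics.QuantumFieldTheory hiding ZdEdge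

namespace Summit.Ventures.YMGap.RobustBall

variable {d N : ℕ}

/-! ### The pair term and its one-link witnesses -/

section Term

variable (N) in
/-- **The two-plaquette term** of the ordered pair `i = (p, q)`: `J(p,q) · (Re tr U_p / N) · (Re tr U_q / N)`. -/
def plaqPairTerm (J : PlaqPairIdx d → ℝ) (i : PlaqPairIdx d)
    (U : LGConfig d (Matrix.specialUnitaryGroup (Fin N) ℂ)) : ℝ :=
  J i * (plaqObsN N i.1 U * plaqObsN N i.2 U)

variable {J : PlaqPairIdx d → ℝ}

/-- Continuity of the term. -/
theorem continuous_plaqPairTerm (i : PlaqPairIdx d) : Continuous (plaqPairTerm (d := d) N J i) :=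
  continuous_const.mul ((continuous_plaqObsN _).mul (continuous_plaqObsN _))

/-- The term reads only its carrier. -/
theorem dependsOn_plaqPairTerm (i : PlaqPairIdx d) :
    DependsOn (plaqPairTerm (d := d) N J i) (↑(plaqPairCode i) : Set (ZdEdge d)) := by
  intro U V hUV
  unfold plaqPairTerm
  rw [plaqObsN_congr (fun e he => hUV e (Finset.mem_coe.2 (Finset.mem_union_left _ he))),
    plaqObsN_congr (p := i.2) (fun e he => hUV e (Finset.mem_coe.2 (Finset.mem_union_right _ he)))]

/-- The size of the term: `|J obs_p obs_q| ≤ |J|`. -/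
theorem abs_plaqPairTerm_le (hN : 1 ≤ N) (i : PlaqPairIdx d) (U : LGConfig d (Matrix.specialUnitaryGroup (Fin N) ℂ)) :
    |plaqPairTerm N J i U| ≤ |J i| := by
  unfold plaqPairTerm
  rw [abs_mul, abs_mul]
  have h1 := abs_plaqObsN_le_one hN i.1 U
  have h2 := abs_plaqObsN_le_one hN i.2 U
  have h12 : |plaqObsN N i.1 U| * |plaqObsN N i.2 U| ≤ 1 := by
    calc _ ≤ 1 * 1 := mul_le_mul h1 h2 (abs_nonneg _) zero_le_one
      _ = 1 := one_mul 1
  exact mul_le_of_le_one_right (abs_nonneg _) h12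

/-- **Oscillation witnesses**: the term oscillates by at most `2|J|` in every link. -/
theorem isOscBound_plaqPairTerm (hN : 1 ≤ N) (i : PlaqPairIdx d) :
    Dobrushin.IsOscBound (plaqPairTerm (d := d) N J i) fun _ => 2 * |J i| := by
  refine ⟨fun y => by positivity, fun y U V _ => ?_⟩
  calc |plaqPairTerm N J i U - plaqPairTerm N J i V| ≤ |plaqPairTerm N J i U| + |plaqPairTerm N J i V| :=
        abs_sub _ _
    _ ≤ |J i| + |J i| := add_le_add (abs_plaqPairTerm_le hN i U) (abs_plaqPairTerm_le hN i V)
    _ = 2 * |J i| := by ring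

/-- **Lipschitz witnesses**: the term is `|J|/√N · (𝟙[y ∈ p] + 𝟙[y ∈ q])`-Lipschitz in the link `y`. -/
theorem isLipBound_plaqPairTerm (hN : 1 ≤ N) (i : PlaqPairIdx d) :
    IsLipBound suFrobDist (plaqPairTerm (d := d) N J i) fun y =>
      |J i| / Real.sqrt N *
        ((if y ∈ plaquetteEdges i.1 then (1 : ℝ) else 0) + (if y ∈ plaquetteEdges i.2 then (1 : ℝ) else 0)) := by
  have hN0 : (0 : ℝ) < N := by exact_mod_cast hN
  refine ⟨fun y => mul_nonneg (by positivity) (add_nonneg (by split_ifs <;> norm_num) (by split_ifs <;> norm_num)),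
    fun y U V hUV => ?_⟩
  set a := plaqObsN N i.1 U with ha
  set a' := plaqObsN N i.1 V with ha'
  set b := plaqObsN N i.2 U with hb
  set b' := plaqObsN N i.2 V with hb'
  set D := suFrobDist (U y) (V y) with hD
  have hD0 : 0 ≤ D := suFrobDist_nonneg _ _
  have hb1 : |b| ≤ 1 := abs_plaqObsN_le_one hN _ U
  have ha'1 : |a'| ≤ 1 := abs_plaqObsN_le_one hN _ V
  have hpa : |a - a'| ≤ (if y ∈ plaquetteEdges i.1 then 1 / Real.sqrt N else 0) * D :=
    abs_plaqObsN_sub_le hN i.1 hUV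
  have hpb : |b - b'| ≤ (if y ∈ plaquetteEdges i.2 then 1 / Real.sqrt N else 0) * D :=
    abs_plaqObsN_sub_le hN i.2 hUV
  have hsplit : a * b - a' * b' = (a - a') * b + a' * (b - b') := by ring
  have hprod : |a * b - a' * b'| ≤ (if y ∈ plaquetteEdges i.1 then 1 / Real.sqrt N else 0) * D +
      (if y ∈ plaquetteEdges i.2 then 1 / Real.sqrt N else 0) * D := by
    rw [hsplit]
    refine (abs_add_le _ _).trans (add_le_add ?_ ?_)
    · rw [abs_mul]
      calc |a - a'| * |b| ≤ (if y ∈ plaquetteEdges i.1 then 1 / Real.sqrt N else 0) * D * 1 :=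
            mul_le_mul hpa hb1 (abs_nonneg _) (mul_nonneg (by split_ifs <;> positivity) hD0)
        _ = _ := mul_one _
    · rw [abs_mul]
      calc |a'| * |b - b'| ≤ 1 * ((if y ∈ plaquetteEdges i.2 then 1 / Real.sqrt N else 0) * D) :=
            mul_le_mul ha'1 hpb (abs_nonneg _) zero_le_one
        _ = _ := one_mul _
  unfold plaqPairTerm
  rw [← ha, ← ha', ← hb, ← hb', ← mul_sub, abs_mul]
  calc |J i| * |a * b - a' * b'|
      ≤ |J i| * ((if y ∈ plaquetteEdges i.1 then 1 / Real.sqrt N else 0) * D +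
          (if y ∈ plaquetteEdges i.2 then 1 / Real.sqrt N else 0) * D) :=
        mul_le_mul_of_nonneg_left hprod (abs_nonneg _)
    _ = |J i| / Real.sqrt N *
          ((if y ∈ plaquetteEdges i.1 then (1 : ℝ) else 0) + (if y ∈ plaquetteEdges i.2 then (1 : ℝ) else 0)) * D := by
        split_ifs <;> field_simp <;> ring

/-- **The weighted cross row of one term**: through a link `e` of its carrier the pair `(p, q)` has
`∑_{y ∈ carrier ∖ e} l(y) e^{t‖e-y‖} ≤ (4/√N)(|J| e^{t} + |J| e^{t(‖x_p - x_q‖_∞ + 1)})` (`t ≥ 0`). -/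
theorem plaqPairTerm_row_le (hN : 1 ≤ N) {t : ℝ} (ht : 0 ≤ t) {e : ZdEdge d} {i : PlaqPairIdx d}
    (he : e ∈ plaqPairCode i) :
    ∑ y ∈ (plaqPairCode i).erase e, |J i| / Real.sqrt N *
        ((if y ∈ plaquetteEdges i.1 then (1 : ℝ) else 0) + (if y ∈ plaquetteEdges i.2 then (1 : ℝ) else 0)) *
        exp (t * ‖e.1 - y.1‖) ≤
      4 / Real.sqrt N * (|J i| * exp t + |J i| * exp (t * (‖i.1.1 - i.2.1‖ + 1))) := by
  have hc0 : 0 ≤ |J i| / Real.sqrt N := by positivity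
  set w : ZdEdge d → ℝ := fun y => exp (t * ‖e.1 - y.1‖) with hw
  have hw0 : ∀ y, 0 ≤ w y := fun y => (exp_pos _).le
  have hχ0 : ∀ y : ZdEdge d, (0 : ℝ) ≤
      (if y ∈ plaquetteEdges i.1 then (1 : ℝ) else 0) + (if y ∈ plaquetteEdges i.2 then (1 : ℝ) else 0) :=
    fun y => add_nonneg (by split_ifs <;> norm_num) (by split_ifs <;> norm_num)
  have hstep1 : ∑ y ∈ (plaqPairCode i).erase e, |J i| / Real.sqrt N *
      ((if y ∈ plaquetteEdges i.1 then (1 : ℝ) else 0) + (if y ∈ plaquetteEdges i.2 then (1 : ℝ) else 0)) * w y ≤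
      ∑ y ∈ plaqPairCode i, |J i| / Real.sqrt N *
      ((if y ∈ plaquetteEdges i.1 then (1 : ℝ) else 0) + (if y ∈ plaquetteEdges i.2 then (1 : ℝ) else 0)) * w y :=
    Finset.sum_le_sum_of_subset_of_nonneg (Finset.erase_subset _ _) fun y _ _ =>
      mul_nonneg (mul_nonneg hc0 (hχ0 y)) (hw0 y)
  have hsplit : ∑ y ∈ plaqPairCode i, |J i| / Real.sqrt N *
      ((if y ∈ plaquetteEdges i.1 then (1 : ℝ) else 0) + (if y ∈ plaquetteEdges i.2 then (1 : ℝ) else 0)) * w y =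
      |J i| / Real.sqrt N * (∑ y ∈ plaqPairCode i, (if y ∈ plaquetteEdges i.1 then w y else 0) +
        ∑ y ∈ plaqPairCode i, (if y ∈ plaquetteEdges i.2 then w y else 0)) := by
    rw [← Finset.sum_add_distrib, Finset.mul_sum]
    refine Finset.sum_congr rfl fun y _ => ?_
    split_ifs <;> ring
  have hP : ∑ y ∈ plaqPairCode i, (if y ∈ plaquetteEdges i.1 then w y else 0) ≤ ∑ y ∈ plaquetteEdges i.1, w y := by
    rw [← Finset.sum_filter]
    exact Finset.sum_le_sum_of_subset_of_nonneg (fun y hy => (Finset.mem_filter.1 hy).2) fun y _ _ => hw0 y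
  have hQ : ∑ y ∈ plaqPairCode i, (if y ∈ plaquetteEdges i.2 then w y else 0) ≤ ∑ y ∈ plaquetteEdges i.2, w y := by
    rw [← Finset.sum_filter]
    exact Finset.sum_le_sum_of_subset_of_nonneg (fun y hy => (Finset.mem_filter.1 hy).2) fun y _ _ => hw0 y
  have hnear : ∀ {q : ZdPlaquette d}, e ∈ plaquetteEdges q → ∑ y ∈ plaquetteEdges q, w y ≤ 4 * exp t := by
    intro q heq
    refine sum_plaquetteEdges_le_four_mul (exp_pos _).le fun y hy => ?_
    calc w y = exp (t * ‖e.1 - y.1‖) := rfl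
      _ ≤ exp (t * 1) := exp_le_exp.2 (mul_le_mul_of_nonneg_left (norm_sub_le_one_of_mem_plaquetteEdges heq hy) ht)
      _ = exp t := by rw [mul_one]
  have hfarPQ : e ∈ plaquetteEdges i.1 → ∑ y ∈ plaquetteEdges i.2, w y ≤ 4 * exp (t * (‖i.1.1 - i.2.1‖ + 1)) := by
    intro hep
    refine sum_plaquetteEdges_le_four_mul (exp_pos _).le fun y hy => ?_
    exact exp_le_exp.2 (mul_le_mul_of_nonneg_left (norm_sub_le_norm_base_sub_add_one hep hy) ht)
  have hfarQP : e ∈ plaquetteEdges i.2 → ∑ y ∈ plaquetteEdges i.1, w y ≤ 4 * exp (t * (‖i.1.1 - i.2.1‖ + 1)) := by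
    intro heq
    refine sum_plaquetteEdges_le_four_mul (exp_pos _).le fun y hy => ?_
    have h := norm_sub_le_norm_base_sub_add_one heq hy
    rw [← norm_neg (i.2.1 - i.1.1), neg_sub] at h
    exact exp_le_exp.2 (mul_le_mul_of_nonneg_left h ht)
  have htwo : ∑ y ∈ plaquetteEdges i.1, w y + ∑ y ∈ plaquetteEdges i.2, w y ≤
      4 * exp t + 4 * exp (t * (‖i.1.1 - i.2.1‖ + 1)) := by
    rcases Finset.mem_union.1 he with h1 | h2
    · exact add_le_add (hnear h1) (hfarPQ h1)
    · calc ∑ y ∈ plaquetteEdges i.1, w y + ∑ y ∈ plaquetteEdges i.2, w y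
          ≤ 4 * exp (t * (‖i.1.1 - i.2.1‖ + 1)) + 4 * exp t := add_le_add (hfarQP h2) (hnear h2)
        _ = _ := add_comm _ _
  refine hstep1.trans ?_
  rw [hsplit]
  calc |J i| / Real.sqrt N * (∑ y ∈ plaqPairCode i, (if y ∈ plaquetteEdges i.1 then w y else 0) +
          ∑ y ∈ plaqPairCode i, (if y ∈ plaquetteEdges i.2 then w y else 0))
      ≤ |J i| / Real.sqrt N * (4 * exp t + 4 * exp (t * (‖i.1.1 - i.2.1‖ + 1))) :=
        mul_le_mul_of_nonneg_left ((add_le_add hP hQ).trans htwo) hc0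
    _ = 4 / Real.sqrt N * (|J i| * exp t + |J i| * exp (t * (‖i.1.1 - i.2.1‖ + 1))) := by ring

end Term

/-! ### The coupling potential and its membership in the weighted ball -/

section Member

variable (N) in
/-- **The two-plaquette coupling potential** of `J`: on each link set `X`, the sum of the pair terms carried by `X`. -/
def plaqPairCoupling (J : PlaqPairIdx d → ℝ) : Potential (ZdEdge d) (Matrix.specialUnitaryGroup (Fin N) ℂ) :=
  indexedPotential plaqPairFib (plaqPairTerm N J)

variable {J : PlaqPairIdx d → ℝ} {t : ℝ}

/-- **EVERY SUMMABLE TWO-PLAQUETTE COUPLING IS A MEMBER OF THE WEIGHTED BALL.** If the rows and columns of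
`|J|` are summable with `∑_q |J(p,q)| ≤ K₀`, `∑_p |J(p,q)| ≤ K₀'`, and at weight `t ≥ 0`
`∑_q |J(p,q)| e^{t(‖x_p-x_q‖∞+1)} ≤ K_t`, `∑_p |J(p,q)| e^{t(‖x_p-x_q‖∞+1)} ≤ K_t'`, then
`plaqPairCoupling N J ∈ MemBallZdS (4(d-1)(K₀+K₀')) (8(d-1)(e^{t}(K₀+K₀') + K_t + K_t')/√N) t`. -/
theorem memBallZdS_plaqPairCoupling (hd : 1 ≤ d) (hN : 1 ≤ N) (ht : 0 ≤ t) {K₀ K₀' Kt Kt' : ℝ}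
    (hK₀ : 0 ≤ K₀) (hK₀' : 0 ≤ K₀') (hKt : 0 ≤ Kt) (hKt' : 0 ≤ Kt')
    (hrow₀ : ∀ p, Summable fun q => |J (p, q)|) (hrowK₀ : ∀ p, ∑' q, |J (p, q)| ≤ K₀)
    (hcol₀ : ∀ q, Summable fun p => |J (p, q)|) (hcolK₀ : ∀ q, ∑' p, |J (p, q)| ≤ K₀')
    (hrowt : ∀ p, Summable fun q => |J (p, q)| * exp (t * (‖p.1 - q.1‖ + 1)))
    (hrowKt : ∀ p, ∑' q, |J (p, q)| * exp (t * (‖p.1 - q.1‖ + 1)) ≤ Kt)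
    (hcolt : ∀ q, Summable fun p => |J (p, q)| * exp (t * (‖p.1 - q.1‖ + 1)))
    (hcolKt : ∀ q, ∑' p, |J (p, q)| * exp (t * (‖p.1 - q.1‖ + 1)) ≤ Kt') :
    MemBallZdS (4 * ((d : ℝ) - 1) * (K₀ + K₀'))
      (8 * ((d : ℝ) - 1) * (exp t * (K₀ + K₀') + (Kt + Kt')) / Real.sqrt N) t
      (plaqPairCoupling (d := d) N J) := by
  have hN0 : (0 : ℝ) < N := by exact_mod_cast hN
  have hind0 : ∀ (e : ZdEdge d) (i : PlaqPairIdx d), (0 : ℝ) ≤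
      (if e ∈ plaquetteEdges i.1 then (1 : ℝ) else 0) + (if e ∈ plaquetteEdges i.2 then (1 : ℝ) else 0) :=
    fun e i => add_nonneg (by split_ifs <;> norm_num) (by split_ifs <;> norm_num)
  have hind1 : ∀ (e : ZdEdge d) (i : PlaqPairIdx d), e ∈ plaqPairCode i → (1 : ℝ) ≤
      (if e ∈ plaquetteEdges i.1 then (1 : ℝ) else 0) + (if e ∈ plaquetteEdges i.2 then (1 : ℝ) else 0) := by
    intro e i h
    rcases Finset.mem_union.1 h with h1 | h2
    · rw [if_pos h1]
      have : (0 : ℝ) ≤ (if e ∈ plaquetteEdges i.2 then (1 : ℝ) else 0) := by split_ifs <;> norm_num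
      linarith
    · rw [if_pos h2]
      have : (0 : ℝ) ≤ (if e ∈ plaquetteEdges i.1 then (1 : ℝ) else 0) := by split_ifs <;> norm_num
      linarith
  have hite : ∀ (e : ZdEdge d) (i : PlaqPairIdx d) {x : ℝ}, 0 ≤ x →
      (if e ∈ plaqPairCode i then x else 0) ≤
        ((if e ∈ plaquetteEdges i.1 then (1 : ℝ) else 0) + (if e ∈ plaquetteEdges i.2 then (1 : ℝ) else 0)) * x := by
    intro e i x hx
    by_cases h : e ∈ plaqPairCode i
    · rw [if_pos h]; exact le_mul_of_one_le_left hx (hind1 e i h)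
    · rw [if_neg h]; exact mul_nonneg (hind0 e i) hx
  -- (M)/(o)/(l self): weights `|J|`, `2|J|`, `|J|/√N`
  have hM : ∀ e : ZdEdge d, Summable fun i : PlaqPairIdx d => if e ∈ plaqPairCode i then |J i| else 0 :=
    fun e => (summable_and_tsum_le_of_le_pair_incidence hd (w := fun i => |J i|) (fun i => abs_nonneg _)
      hrow₀ hK₀ hrowK₀ hcol₀ hK₀' hcolK₀ e
      (g := fun i => if e ∈ plaqPairCode i then |J i| else 0) (fun i => by positivity)
      (fun i => hite e i (abs_nonneg _))).1
  have ho : ∀ e : ZdEdge d,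
      (Summable fun i : PlaqPairIdx d => if e ∈ plaqPairCode i then 2 * |J i| else 0) ∧
        ∑' i : PlaqPairIdx d, (if e ∈ plaqPairCode i then 2 * |J i| else 0) ≤
          2 * ((d : ℝ) - 1) * (2 * K₀ + 2 * K₀') := by
    intro e
    refine summable_and_tsum_le_of_le_pair_incidence hd (w := fun i => 2 * |J i|) (fun i => by positivity)
      (fun p => (hrow₀ p).mul_left 2) (by positivity) (fun p => ?_) (fun q => (hcol₀ q).mul_left 2) (by positivity)
      (fun q => ?_) e (g := fun i => if e ∈ plaqPairCode i then 2 * |J i| else 0) (fun i => by positivity)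
      (fun i => hite e i (by positivity))
    · rw [tsum_mul_left]; exact mul_le_mul_of_nonneg_left (hrowK₀ p) zero_le_two
    · rw [tsum_mul_left]; exact mul_le_mul_of_nonneg_left (hcolK₀ q) zero_le_two
  have hl0 : ∀ (e : ZdEdge d) (i : PlaqPairIdx d), (0 : ℝ) ≤
      (if e ∈ plaqPairCode i then |J i| / Real.sqrt N *
        ((if e ∈ plaquetteEdges i.1 then (1 : ℝ) else 0) + (if e ∈ plaquetteEdges i.2 then (1 : ℝ) else 0))
      else 0) := by
    intro e i
    by_cases h : e ∈ plaqPairCode i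
    · rw [if_pos h]; exact mul_nonneg (by positivity) (hind0 e i)
    · rw [if_neg h]
  have hl : ∀ e : ZdEdge d, Summable fun i : PlaqPairIdx d =>
      if e ∈ plaqPairCode i then |J i| / Real.sqrt N *
        ((if e ∈ plaquetteEdges i.1 then (1 : ℝ) else 0) + (if e ∈ plaquetteEdges i.2 then (1 : ℝ) else 0))
      else 0 := by
    intro e
    refine (summable_and_tsum_le_of_le_pair_incidence hd (w := fun i => |J i| / Real.sqrt N)
      (fun i => by positivity) (fun p => (hrow₀ p).div_const _) (K := K₀ / Real.sqrt N) (by positivity)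
      (fun p => ?_) (fun q => (hcol₀ q).div_const _) (K' := K₀' / Real.sqrt N) (by positivity) (fun q => ?_)
      e (hl0 e) (fun i => ?_)).1
    · rw [tsum_div_const]; exact div_le_div_of_nonneg_right (hrowK₀ p) (Real.sqrt_nonneg _)
    · rw [tsum_div_const]; exact div_le_div_of_nonneg_right (hcolK₀ q) (Real.sqrt_nonneg _)
    · by_cases h : e ∈ plaqPairCode i
      · rw [if_pos h, mul_comm]
      · rw [if_neg h]; exact mul_nonneg (hind0 e i) (by positivity)
  -- (row): weights `(4/√N)(|J| e^t + |J| e^{t(D+1)})`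
  have hrow0 : ∀ (e : ZdEdge d) (i : PlaqPairIdx d), (0 : ℝ) ≤
      (if e ∈ plaqPairCode i then ∑ y ∈ (plaqPairCode i).erase e, |J i| / Real.sqrt N *
        ((if y ∈ plaquetteEdges i.1 then (1 : ℝ) else 0) + (if y ∈ plaquetteEdges i.2 then (1 : ℝ) else 0)) *
        exp (t * ‖e.1 - y.1‖) else 0) := by
    intro e i
    by_cases h : e ∈ plaqPairCode i
    · rw [if_pos h]
      exact Finset.sum_nonneg fun y _ => mul_nonneg (mul_nonneg (by positivity) (hind0 y i)) (exp_pos _).le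
    · rw [if_neg h]
  have hwrow : ∀ p, Summable fun q => 4 / Real.sqrt N *
      (|J (p, q)| * exp t + |J (p, q)| * exp (t * (‖p.1 - q.1‖ + 1))) :=
    fun p => (((hrow₀ p).mul_right _).add (hrowt p)).mul_left _
  have hwcol : ∀ q, Summable fun p => 4 / Real.sqrt N *
      (|J (p, q)| * exp t + |J (p, q)| * exp (t * (‖p.1 - q.1‖ + 1))) :=
    fun q => (((hcol₀ q).mul_right _).add (hcolt q)).mul_left _
  have hwrowK : ∀ p, ∑' q, 4 / Real.sqrt N * (|J (p, q)| * exp t + |J (p, q)| * exp (t * (‖p.1 - q.1‖ + 1))) ≤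
      4 / Real.sqrt N * (K₀ * exp t + Kt) := by
    intro p
    rw [tsum_mul_left, ((hrow₀ p).mul_right _).tsum_add (hrowt p), tsum_mul_right]
    exact mul_le_mul_of_nonneg_left (add_le_add (mul_le_mul_of_nonneg_right (hrowK₀ p) (exp_pos _).le)
      (hrowKt p)) (by positivity)
  have hwcolK : ∀ q, ∑' p, 4 / Real.sqrt N * (|J (p, q)| * exp t + |J (p, q)| * exp (t * (‖p.1 - q.1‖ + 1))) ≤
      4 / Real.sqrt N * (K₀' * exp t + Kt') := by
    intro q
    rw [tsum_mul_left, ((hcol₀ q).mul_right _).tsum_add (hcolt q), tsum_mul_right]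
    exact mul_le_mul_of_nonneg_left (add_le_add (mul_le_mul_of_nonneg_right (hcolK₀ q) (exp_pos _).le)
      (hcolKt q)) (by positivity)
  have hrow : ∀ e : ZdEdge d,
      (Summable fun i : PlaqPairIdx d =>
        if e ∈ plaqPairCode i then ∑ y ∈ (plaqPairCode i).erase e, |J i| / Real.sqrt N *
          ((if y ∈ plaquetteEdges i.1 then (1 : ℝ) else 0) + (if y ∈ plaquetteEdges i.2 then (1 : ℝ) else 0)) *
          exp (t * ‖e.1 - y.1‖) else 0) ∧
      ∑' i : PlaqPairIdx d, (if e ∈ plaqPairCode i then ∑ y ∈ (plaqPairCode i).erase e, |J i| / Real.sqrt N *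
          ((if y ∈ plaquetteEdges i.1 then (1 : ℝ) else 0) + (if y ∈ plaquetteEdges i.2 then (1 : ℝ) else 0)) *
          exp (t * ‖e.1 - y.1‖) else 0) ≤
        2 * ((d : ℝ) - 1) * (4 / Real.sqrt N * (K₀ * exp t + Kt) + 4 / Real.sqrt N * (K₀' * exp t + Kt')) := by
    intro e
    refine summable_and_tsum_le_of_le_pair_incidence hd
      (w := fun i => 4 / Real.sqrt N * (|J i| * exp t + |J i| * exp (t * (‖i.1.1 - i.2.1‖ + 1))))
      (fun i => by positivity) hwrow (by positivity) hwrowK hwcol (by positivity) hwcolK e (hrow0 e) (fun i => ?_)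
    by_cases h : e ∈ plaqPairCode i
    · rw [if_pos h]
      refine (plaqPairTerm_row_le hN ht h).trans ?_
      have hw0 : 0 ≤ 4 / Real.sqrt N * (|J i| * exp t + |J i| * exp (t * (‖i.1.1 - i.2.1‖ + 1))) := by positivity
      exact le_mul_of_one_le_left hw0 (hind1 e i h)
    · rw [if_neg h]
      exact mul_nonneg (hind0 e i) (by positivity)
  -- assemble
  have hmem := memBallZdS_indexed (code := plaqPairCode) (fib := plaqPairFib) (φ := plaqPairTerm N J) mem_plaqPairFib
    continuous_plaqPairTerm dependsOn_plaqPairTerm (M := fun i => |J i|) (abs_plaqPairTerm_le hN)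
    hM (isOscBound_plaqPairTerm hN) (isLipBound_plaqPairTerm hN) (t := t)
    (fun e => (ho e).1) (fun e => (ho e).2) hl (fun e => (hrow e).1) (fun e => (hrow e).2)
  have ha : 2 * ((d : ℝ) - 1) * (2 * K₀ + 2 * K₀') = 4 * ((d : ℝ) - 1) * (K₀ + K₀') := by ring
  have hΛ : 2 * ((d : ℝ) - 1) * (4 / Real.sqrt N * (K₀ * exp t + Kt) + 4 / Real.sqrt N * (K₀' * exp t + Kt')) =
      8 * ((d : ℝ) - 1) * (exp t * (K₀ + K₀') + (Kt + Kt')) / Real.sqrt N := by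
    field_simp
    ring
  rw [ha, hΛ] at hmem
  exact hmem

end Member

end Summit.Ventures.YMGap.RobustBall
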